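import Summits.ABC.ABC.Theorems.IsogenyGlueCongruenceEllipticGluingPrimeBoundOfSimpleThree
import Summits.ABC.ABC.Theorems.IsogenyGlueCongruenceEllipticGluingPrimeBoundStubCMTorsionCartanImage
import Literature.NumberTheory.EllipticCurves.MasserWustholzOfGaudronRemondProofs
import Literature.NumberTheory.EllipticCurves.OpenImageMazurInputsProofs
import HarnessLib

/-!
# Crux U `EllipticGluingPrimeBound` (stmt-ABC-13919): the reduction to `U_simple` with the CM
# input discharged, and re-based on the route's SHARED apex facts

Line `Sketch` (isotypic–Minkowski reduction) landed `ellipticGluingPrimeBound_of_simple`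
(…OfSimpleThree.lean, p118731): Masser–Wüstholz surjectivity + the CM torsion fact + the route item
`FaltingsTate` + `U_simple` ⟹ U, and the equivalence `ellipticGluingPrimeBound_iff_simple`.
Two of those inputs have since moved in the Literature:

* the CM torsion fact `cmTorsion_cartanImage` is PROVED (`cmTorsion_cartanImage_holds`; the
  line's stub `stub_cmTorsionCartanImage` is landed through it, p119892);
* Masser–Wüstholz 1993 Thm (b) over `ℚ` (`masserWustholz_surjective_modEll`) is DERIVED from
  Mazur's isogeny theorem and the Gaudron–Rémond pair isogeny theorem
  (`MasserWustholz1993.masserWustholz_surjective_modEll_of_mazur_of_gaudronRemond`), and Mazur's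
  theorem from its one remaining printed input Cor. 4.4 (`mazur_isogeny_irreducible_holds_of`
  with `Mazur1978.prop51_exponent_classes_of_additive_holds`).

Hence the crux's conditional reduction can be stated on exactly TWO inputs plus the route item:

* `ellipticGluingPrimeBound_of_simple_of_masserWustholz` — MW + `FaltingsTate` + `U_simple` ⟹ U;
* `ellipticGluingPrimeBound_of_simple_of_cor44_of_gaudronRemond` — Mazur 1978 Cor. 4.4
  (`Mazur1978.cor44_valuation_j_le_one`, the Eisenstein-quotient input shared with the route's
  `MazurKenkuBound` line) + Gaudron–Rémond pairs (`GaudronRemond2023_torsionHom_ellipticPair`,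
  shared with `PolyFreyMazurPairs`) + `FaltingsTate` + `U_simple` ⟹ U;
* `ellipticGluingPrimeBound_iff_simple_of_cor44_of_gaudronRemond` — modulo those shared inputs
  the crux is EQUIVALENT to `U_simple` (`→` unconditional, p117529).

So the trust base of any closing of U along this line is {Cor. 4.4, GR pairs, Faltings} and
`U_simple`, the first three shared with the rest of route `IsogenyGlueCongruence`; `U_simple` (height-free
torsion sharing with ℚ-simple geometrically `E`-free partners) remains the open core.
Lands `--supports stmt-ABC-13919` (registered sub-goals). No definitions; no `sorry`.
-/

noncomputable section

-- `Summit.<Summit>.<Problem>` is the mandated summit-side namespace (CONVENTIONS §2); for the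
-- single-conjunct summit `ABC` the two coincide, so the duplicate `ABC.ABC` is deliberate.
set_option linter.dupNamespace false

namespace Summit.ABC.ABC.Theorems.IsotypicMinkowski

open CategoryTheory CategoryTheory.Limits AlgebraicGeometry
open Literature.AlgebraicGeometry.Motives
open Summit.ABC.ABC.Theses.IsogenyGlueCongruence
open Literature.NumberTheory.EllipticCurves Literature.NumberTheory.DiophantineGeometry

/-- **MW + `FaltingsTate` + `U_simple` ⟹ U** (the CM input of `ellipticGluingPrimeBound_of_simple`
discharged by `stub_cmTorsionCartanImage`, p119892). Conditional result. -/
theorem ellipticGluingPrimeBound_of_simple_of_masserWustholz :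
    masserWustholz_surjective_modEll → FaltingsTate →
    (∃ κ C : ℝ, 0 ≤ κ ∧ ∀ (W : WeierstrassCurve ℚ) [W.IsElliptic] (E A : AbelianVariety.{0} ℚ)
      (e : E.geomPoints ≃+ W.geomPoints),
      (∀ (σ : Field.absoluteGaloisGroup ℚ) (P : E.geomPoints), e (σ • P) = σ • e P) →
      (∀ f : E.baseChange (AlgebraicClosure ℚ) ⟶ A.baseChange (AlgebraicClosure ℚ), f = 0) →
      AbelianVariety.IsSimple A →
      ∀ ℓ : ℕ, ℓ.Prime → W.HasIrreducibleModPGaloisRep ℓ →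
      (∃ ι : W.geomTorsion ℓ →+ A.geomPoints, Function.Injective ι ∧
        ∀ (σ : Field.absoluteGaloisGroup ℚ) (P : W.geomTorsion ℓ), ι (σ • P) = σ • ι P) →
        (ℓ : ℝ) ≤ C * (((A.dim : ℝ) + 1) * max 1 W.stableFaltingsHeight) ^ κ) →
    EllipticGluingPrimeBound :=
  fun hMW hFal hS ↦ ellipticGluingPrimeBound_of_simple hMW stub_cmTorsionCartanImage hFal hS

/-- **Cor. 4.4 + GR pairs + `FaltingsTate` + `U_simple` ⟹ U**: the reduction re-based on the
route's shared apex facts — Mazur 1978 Cor. 4.4 gives Mazur's Theorem 1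
(`mazur_isogeny_irreducible_holds_of`, Prop. 5.1 proved), which with the Gaudron–Rémond pair
theorem gives Masser–Wüstholz surjectivity
(`MasserWustholz1993.masserWustholz_surjective_modEll_of_mazur_of_gaudronRemond`); then
`ellipticGluingPrimeBound_of_simple_of_masserWustholz`. Conditional result. -/
theorem ellipticGluingPrimeBound_of_simple_of_cor44_of_gaudronRemond :
    Mazur1978.cor44_valuation_j_le_one → GaudronRemond2023_torsionHom_ellipticPair → FaltingsTate →
    (∃ κ C : ℝ, 0 ≤ κ ∧ ∀ (W : WeierstrassCurve ℚ) [W.IsElliptic] (E A : AbelianVariety.{0} ℚ)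
      (e : E.geomPoints ≃+ W.geomPoints),
      (∀ (σ : Field.absoluteGaloisGroup ℚ) (P : E.geomPoints), e (σ • P) = σ • e P) →
      (∀ f : E.baseChange (AlgebraicClosure ℚ) ⟶ A.baseChange (AlgebraicClosure ℚ), f = 0) →
      AbelianVariety.IsSimple A →
      ∀ ℓ : ℕ, ℓ.Prime → W.HasIrreducibleModPGaloisRep ℓ →
      (∃ ι : W.geomTorsion ℓ →+ A.geomPoints, Function.Injective ι ∧
        ∀ (σ : Field.absoluteGaloisGroup ℚ) (P : W.geomTorsion ℓ), ι (σ • P) = σ • ι P) →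
        (ℓ : ℝ) ≤ C * (((A.dim : ℝ) + 1) * max 1 W.stableFaltingsHeight) ^ κ) →
    EllipticGluingPrimeBound :=
  fun h44 hGR hFal hS ↦ ellipticGluingPrimeBound_of_simple_of_masserWustholz
    (MasserWustholz1993.masserWustholz_surjective_modEll_of_mazur_of_gaudronRemond
      (mazur_isogeny_irreducible_holds_of h44 Mazur1978.prop51_exponent_classes_of_additive_holds)
      hGR) hFal hS

/-- **U ⟺ `U_simple` modulo the shared inputs** {Mazur Cor. 4.4, GR pairs, `FaltingsTate`}:
`→` is the unconditional converse `simpleFreeTorsionBound_of_ellipticGluingPrimeBound` (p117529),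
`←` is `ellipticGluingPrimeBound_of_simple_of_cor44_of_gaudronRemond`. -/
theorem ellipticGluingPrimeBound_iff_simple_of_cor44_of_gaudronRemond :
    Mazur1978.cor44_valuation_j_le_one → GaudronRemond2023_torsionHom_ellipticPair → FaltingsTate →
    (EllipticGluingPrimeBound ↔
    ∃ κ C : ℝ, 0 ≤ κ ∧ ∀ (W : WeierstrassCurve ℚ) [W.IsElliptic] (E A : AbelianVariety.{0} ℚ)
      (e : E.geomPoints ≃+ W.geomPoints),
      (∀ (σ : Field.absoluteGaloisGroup ℚ) (P : E.geomPoints), e (σ • P) = σ • e P) →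
      (∀ f : E.baseChange (AlgebraicClosure ℚ) ⟶ A.baseChange (AlgebraicClosure ℚ), f = 0) →
      AbelianVariety.IsSimple A →
      ∀ ℓ : ℕ, ℓ.Prime → W.HasIrreducibleModPGaloisRep ℓ →
      (∃ ι : W.geomTorsion ℓ →+ A.geomPoints, Function.Injective ι ∧
        ∀ (σ : Field.absoluteGaloisGroup ℚ) (P : W.geomTorsion ℓ), ι (σ • P) = σ • ι P) →
        (ℓ : ℝ) ≤ C * (((A.dim : ℝ) + 1) * max 1 W.stableFaltingsHeight) ^ κ) :=
  fun h44 hGR hFal ↦ ⟨simpleFreeTorsionBound_of_ellipticGluingPrimeBound,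
    ellipticGluingPrimeBound_of_simple_of_cor44_of_gaudronRemond h44 hGR hFal⟩

end Summit.ABC.ABC.Theorems.IsotypicMinkowski

end
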